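import Literature.NumberTheory.EllipticCurves.KezukaLi2020.CubeSumThreePart
import HarnessLib

/-!
# Cai–Shu–Tian 2017 (Amer. J. Math. 139), *Cube sum problem and an explicit Gross–Zagier formula*: Thm. 1.1 and Thm. 1.2 AS PRINTED — the cube sums `2p`, `2p²` for primes `p ≡ 2, 5 (mod 9)`, rank / analytic rank of `x³ + y³ = 2p^{±1}`, and the `ℓ`-part (`ℓ ∤ 2p`) of `#Ш(C^{(p)}) · #Ш(C^{(p⁻¹)})`

HONEST FRAMING (cell `bsd-print-cf2`, D-0131 (2) PRINT TIER, typer seat `ty1`; HOME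
`run/shared/lean/pub/bsd-print-cf2/`): PUBLISHED theorems vendored as named `Prop`s (nothing
asserted, nothing discharged; D-0014), every printed hypothesis a binder, locators into the held
text. The leaf of the cell is CornerF @ `p = 2` (CM, analytic rank one, the prime `2`); the curves of
this file — the cube-sum curves `x³ + y³ = 2p`, `x³ + y³ = 2p²`, CM by `ℤ[ω]`, `K = ℚ(√−3)`, in which
`2` is INERT — are the `ℚ(√−3)` companions named in the cell's charter (row S2b). FLAG AT 2: Theorem
1.2 EXCLUDES `ℓ = 2` (and `ℓ = p`) from its BSD clause: "for any prime `ℓ ∤ 2p`". What it gives at the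
other primes is a PRODUCT statement for the rank-one curve and its rank-zero partner; the separation
into the two factors is done below (PROVED, `bsdp_of_shaAn_mul_of_bsdTriple`) with Burungale–Flach
2024 for the rank-zero CM factor — the same combination step as the tree's
`HuShuYin2019.bsdp_three_of_threePart_product`, `ShuYin2022`, and as Kezuka–Li 2020 Cor. 1.2 (which
re-derives the `3`-part individually; tree `KezukaLi2020.cor12_threePart_of_cubeSum`). Nothing is
booked here; the cell's referee reads the hypotheses.

Source. L. Cai, J. Shu, Y. Tian, *Cube sum problem and an explicit Gross–Zagier formula*, Amer. J.
Math. **139** (2017), no. 3, 785–816, doi:10.1353/ajm.2017.0021 [CaiShuTian2017] (PUBLISHED,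
refereed). Text read: arXiv:1412.1950 (LaTeX-derived chunks `p0001`–`p0018` of the lit store key
`paper:arxiv-1412.1950`; no PDF pagination, locators below are `chunk:line`); the theorem numbers
1.1 / 1.2 / 1.8 are those of the arXiv text read — the journal (AJM) pagination and numbering were NOT
checked against the paywalled version of record; the citing literature restates the CONTENT without
theorem numbers: Kezuka–Li, Doc. Math. 25 (2020) p. 2115 ("it was shown in [2] that, for all odd
primes `p` satisfying (1.1) the `3`-part of the Birch–Swinnerton-Dyer conjecture holds for the product
of the two curves `C_{2p} × C_{2p²}`"), Hu–Shu–Yin 2019 p. 3 (`[CST17]`).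

## The printed statements (verbatim, §1 = chunk p0002)

* Definition (p0002 L3): "We call a nonzero rational number a cube sum if it is of form `a³ + b³`
  with `a, b ∈ ℚ^×`."
* **Theorem 1.1** (p0002 L5–L6): "For any odd integer `k ≥ 1`, there exist infinitely many
  cube-free odd integers `n` with exactly `k` distinct prime factors such that `2n` is a cube sum
  (resp. not a cube sum)."
* The curves (p0002 L8): "For any `n ∈ ℚ^×`, let `C^{(n)}` be the elliptic curve over `ℚ` defined by
  the equation `x³ + y³ = 2n`. Note that the torsion part of the Mordell–Weil group `C^{(n)}(ℚ)` is
  trivial unless `2n` is a cube, which is not a cube sum by our convention. Then `2n` is a cube sum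
  if and only if the rank of the Mordell–Weil group `C^{(n)}(ℚ)` is positive."
* (p0002 L10): "For an odd prime `p ≡ 2, 5 mod 9`, denote `p* = p^{±1} ≡ 2 mod 9`. To prove that
  `p*` is a cube sum, Satgé [Satge] constructed a non-trivial Heegner point on `C^{(p*)}` (see also
  Dasgupta and Voight [DV].)" … (L13–L14) "Together with work of Kolyvagin [K], Perrin-Riou
  [Perrin-Riou] and Kobayashi [Kobayashi], we have the following result on the Birch and
  Swinnerton-Dyer conjecture for `C^{(p*)}` and `C^{(p*⁻¹)}`."
* **Theorem 1.2** (p0002 L16–L23): "Let `p ≡ 2, 5 mod 9` be an odd prime number. Then `2p*` is a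
  cube sum. Moreover,
  • `ord_{s=1} L(s, C^{(p*)}) = rank_ℤ C^{(p*)}(ℚ) = 1` and
    `ord_{s=1} L(s, C^{(p*⁻¹)}) = rank_ℤ C^{(p*⁻¹)}(ℚ) = 0`.
  • The Tate–Shafarevich groups `Ш(C^{(p)})` and `Ш(C^{(p⁻¹)})` are finite, and, for any prime
    `ℓ ∤ 2p`, the `ℓ`-part of `#Ш(C^{(p)}) · #Ш(C^{(p⁻¹)})` is as predicted by the Birch and
    Swinnerton-Dyer conjecture for `C^{(p)}` and `C^{(p⁻¹)}`."
* Proof of Thm. 1.2 (chunk p0017 L51–L69): via the `3`-isogenous curves `E^{(n)} : y² = x³ + n²`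
  ("`E^{(n)}` is isogenous to `C^{(n)}` over `ℚ`", p0005 L33), `L'(1, E, χ_n) = L'(1,E^{(n)})
  L(1,E^{(n⁻¹)}) ≠ 0`, Gross–Zagier–Kolyvagin, "Tamagawa numbers `c_v(E^{(n)}) = c_v(E^{(n⁻¹)}) = 3`
  for `v ∣ 2p` and `= 1` for other places", `E^{(n)}(ℚ) ≃ ℤ/3ℤ`, the displays `BSD(n)`:
  `L'(1,E^{(n)})/Ω^{(n)} = #Ш(E^{(n)}) ĥ_ℚ(P)` and `BSD(n⁻¹)`: `L(1,E^{(n⁻¹)})/Ω^{(n⁻¹)} = #Ш(E^{(n⁻¹)})`,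
  "Then `BSD(n)·BSD(n⁻¹)` is `L'(1,E,χ_n)/Ω^{(n)}Ω^{(n⁻¹)} = #Ш(E^{(n⁻¹)}) · #Ш(E^{(n)}) · ĥ_ℚ(P)`"; the
  `3`-part by the `3`-indivisibility of the Heegner point (Lemma 3.9), the `ℓ`-part for `ℓ ∤ 6p` by
  "Kolyvagin [K], Perrin-Riou [Perrin-Riou] and Kobayashi [Kobayashi]" (p0006 L7).
* **Corollary 1.8** (explicit Gross–Zagier formula on `X₀(36) = (y² = x³ + 1)`, p0005 L63–L74): for
  `k` odd, `p₁, …, p_k` distinct odd primes `≡ 2, 5 mod 9`, `n = p₁*^{ε₁} ⋯ p_k*^{ε_k}`, `εᵢ = ±1`,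
  `∑ εᵢ ≡ 1 mod 3`, the Heegner divisor `z_n := ∑_{σ ∈ Gal(H_{6N}/K)} [χ_n⁻¹(σ)] f(P₀)^σ ∈
  E(K(∛n))^{χ_n}` satisfies `L'(1,E^{(n)}) L(1,E^{(n⁻¹)}) = 3⁻³ · Ω^{(n)} Ω^{(n⁻¹)} · ĥ_ℚ(z_n)` — NOT
  typed here: it needs the CM point `P₀ ∈ X₀(36)(H_{6N})` of conductor `6N` for the specific
  embedding `K ↪ M₂(ℚ)` of §2 (`R₀(36) ∩ K = 𝒪_{6N}`, admissible at `3`), which the tree's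
  `Γ₀(N)`-Heegner vocabulary (`ModularParametrizationData`, `CaiShuTian2014.thm11_ringClassChar`,
  hypothesis `(c, N) = 1`) does not cover; recorded for the cell's provers (p3) as the printed source
  of the height identity. Theorems 1.3 / 1.6 / 1.7 (Gross–Zagier on Shimura curves `X_Γ` attached to
  a quaternion algebra ramified at `Σ`) are likewise not typed (no Shimura curves in Mathlib).

## Transcription (tree dictionary)

* "cube sum": `IsCubeSum r := r ≠ 0 ∧ ∃ a b ∈ ℚ^×, a³ + b³ = r` — the printed definition, with body.
* "cube-free odd integers `n` with exactly `k` distinct prime factors": `n : ℕ`, `Odd n`,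
  `∀ q prime, ¬ q³ ∣ n`, `n.primeFactors.card = k`; "infinitely many": `Set.Infinite`.
* `C^{(p)} : x³ + y³ = 2p` and `C^{(p⁻¹)} : x³ + y³ = 2p⁻¹`. The projective cubic `X³ + Y³ = D Z³`
  is the Weierstrass curve `y² = x³ − 432 D²` (tree: `HuShuYin2019.cubeSumCurve D`,
  `mordellCurve (−432 D²)`; Dasgupta–Voight 2018 §1.1); for `D = 2p^j` the substitution
  `(x, y) ↦ (4x, 8y)` gives `y² = x³ − 27 p^{2j}`, which is the tree's
  `KezukaLi2020.cubeSumTwoModel p j` (Kezuka–Li 2020, (4.1): "gives a minimal model of `C_{2p^j}`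
  at `2`"); and `x³ + y³ = 2p⁻¹` is `ℚ`-isomorphic to `x³ + y³ = 2p²` by `(x, y) ↦ (px, py)`. So
  `C^{(p)} ≅_ℚ cubeSumTwoModel p 1` and `C^{(p⁻¹)} ≅_ℚ cubeSumTwoModel p 2`, and (as in the tree's
  Kezuka–Li / Hu–Shu–Yin files) every clause is stated for ANY globally minimal models `W₁`, `W₂`
  that are `ℚ`-isomorphic (`VariableChange`) to these two — Mordell–Weil rank, analytic rank, `Ш`
  are `ℚ`-isomorphism invariants, and Miller's `#Ш_an` (`shaAn`) is the printed BSD prediction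
  exactly on a globally minimal model. `p* = p` if `p ≡ 2 (mod 9)` and `p* = p⁻¹` if
  `p ≡ 5 (mod 9)` (`5 · 2 ≡ 1 mod 9`), so "`2p*` is a cube sum" reads `IsCubeSum (2p)` resp.
  `IsCubeSum (2/p)` (equivalently `2p²`: multiply by the cube `p³`), and the rank-one curve is `W₁`
  resp. `W₂`.
* "the `ℓ`-part of `#Ш(C^{(p)}) · #Ш(C^{(p⁻¹)})` is as predicted by the BSD conjecture for `C^{(p)}`
  and `C^{(p⁻¹)}`": the predicted value of `#Ш(W)` is Miller's `#Ш(W)_an = shaAn W`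
  (`L^{(r)}(E,1)/r! · #tor² / (Ω ∏c_v Reg)`, `BSDRootNumberSmallConductorProofs`), so the clause is:
  the product `shaAn W₁ · shaAn W₂` is a rational number `q` with
  `ord_ℓ q = ord_ℓ (#Ш(W₁)[ℓ^∞] · #Ш(W₂)[ℓ^∞])` (for finite `Ш`, `#Ш[ℓ^∞]` IS the `ℓ`-part of `#Ш`;
  this is the shape of Miller's `BSDp`, one prime at a time, for the product). Isogeny invariance
  of the BSD quotient (Cassels) makes the authors' passage through `E^{(n)}` immaterial.
* "ord_{s=1} L(s, C)" = `analyticRank`; "rank_ℤ C(ℚ)" = `mordellWeilRank`; "`Ш(C)` finite" =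
  `Finite W.sha`.
Nothing weaker or stronger is transcribed; `ℓ = 2` and `ℓ = p` are outside the statement. No
`_holds` is expected (Heegner points on `X₀(36)` of conductor `6N`, the explicit Gross–Zagier
formula Thm. 1.7, Kolyvagin, Perrin-Riou / Kobayashi `p`-adic heights: none in Mathlib).
Consumers take `(h : thm12_bsd_cubeSum_twicePrime)`.

This file is STATEMENT-ONLY. The bookkeeping consequences are PROVED in the sibling
`CaiShuTian2017/CubeSumTwicePrimesProofs.lean`: `cubeSumTwoModel` has `c₄ = 0`, hence `j = 0` and
CM; the COMBINATION STEP `bsdp_of_shaAn_mul_of_bsdTriple` (a product `ord_ℓ` identity for `B × A`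
+ RANK ∧ SHAFIN ∧ LEAD for `A` ⇒ Miller's `BSD(B, ℓ)`); and its instances: `BSD(C_{2p}, ℓ)`
(`p ≡ 2 mod 9`) resp. `BSD(C_{2p²}, ℓ)` (`p ≡ 5 mod 9`) for every prime `ℓ ∤ 2p`, granted the tree's
Burungale–Flach fact `bsdTriple_of_hasCM_of_L_one_ne_zero` and modularity `hasEntireLFunction_rat`.

## References
* [CaiShuTian2017] L. Cai, J. Shu, Y. Tian, Amer. J. Math. 139 (2017) 785–816 = arXiv:1412.1950:
  §1 (Thm. 1.1, Thm. 1.2, Cor. 1.8; chunk p0002, p0005), proof of Thm. 1.2 (chunk p0017).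
* [KezukaLi2020] Y. Kezuka, Y. Li, Doc. Math. 25 (2020) 2115–2147: p. 2115 (the citation of [2]),
  (4.1) p. 2139 (the model `y² = x³ − 27p^{2j}`), Cor. 1.2.
* [BurungaleFlach2024] A. Burungale, M. Flach, Camb. J. Math. 12 (2024), Thm. 1.1 / Cor. 2 (tree
  `bsdTriple_of_hasCM_of_L_one_ne_zero`).
* [Miller2011LMS] R. L. Miller, LMS J. Comput. Math. 14 (2011), Def. 1.1 (`BSD(E,p)`).
* P. Satgé, *Un analogue du calcul de Heegner*, Invent. Math. 87 (1987) 425–439 (CST's [Satge]).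
-/

noncomputable section

open scoped Classical

open WeierstrassCurve Literature.NumberTheory.EllipticCurves
  Literature.NumberTheory.EllipticCurves.KezukaLi2020

namespace Literature.NumberTheory.EllipticCurves.CaiShuTian2017

/-! ### §1. Vocabulary (definitions with bodies; nothing asserted) -/

/-- **"cube sum"** (Cai–Shu–Tian 2017, §1, first sentence): "We call a nonzero rational number a
cube sum if it is of form `a³ + b³` with `a, b ∈ ℚ^×`."
[cite: CaiShuTian2017, §1 (arXiv:1412.1950 chunk p0002 L3)] -/
def IsCubeSum (r : ℚ) : Prop :=
  r ≠ 0 ∧ ∃ a b : ℚ, a ≠ 0 ∧ b ≠ 0 ∧ a ^ 3 + b ^ 3 = r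

/-- Unfolding of `IsCubeSum`. [cite: CaiShuTian2017, §1 (arXiv chunk p0002 L3)] -/
theorem isCubeSum_iff (r : ℚ) :
    IsCubeSum r ↔ r ≠ 0 ∧ ∃ a b : ℚ, a ≠ 0 ∧ b ≠ 0 ∧ a ^ 3 + b ^ 3 = r :=
  Iff.rfl

/-! ### §2. The printed theorems (named facts; nothing asserted) -/

/-- **Cai–Shu–Tian 2017, Theorem 1.1** (verbatim in the module docstring): "For any odd integer
`k ≥ 1`, there exist infinitely many cube-free odd integers `n` with exactly `k` distinct prime
factors such that `2n` is a cube sum (resp. not a cube sum)." Transcription: for every odd `k`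
(then `k ≥ 1`), both sets `{n odd, cube-free, #primeFactors n = k, 2n (not) a cube sum}` are
infinite. [cite: CaiShuTian2017, Thm. 1.1 (arXiv:1412.1950 chunk p0002 L5–L6)] -/
def thm11_infinitely_many_twice_cubeSums : Prop :=
  ∀ k : ℕ, Odd k →
    {n : ℕ | Odd n ∧ (∀ q : ℕ, q.Prime → ¬ q ^ 3 ∣ n) ∧ n.primeFactors.card = k ∧
        IsCubeSum (2 * (n : ℚ))}.Infinite ∧
    {n : ℕ | Odd n ∧ (∀ q : ℕ, q.Prime → ¬ q ^ 3 ∣ n) ∧ n.primeFactors.card = k ∧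
        ¬ IsCubeSum (2 * (n : ℚ))}.Infinite

/-- **Cai–Shu–Tian 2017, Theorem 1.2** (verbatim in the module docstring): "Let `p ≡ 2, 5 mod 9`
be an odd prime number. Then `2p*` is a cube sum. Moreover, • `ord_{s=1} L(s,C^{(p*)}) =
rank_ℤ C^{(p*)}(ℚ) = 1` and `ord_{s=1} L(s,C^{(p*⁻¹)}) = rank_ℤ C^{(p*⁻¹)}(ℚ) = 0`. • The
Tate–Shafarevich groups `Ш(C^{(p)})` and `Ш(C^{(p⁻¹)})` are finite, and, for any prime `ℓ ∤ 2p`,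
the `ℓ`-part of `#Ш(C^{(p)}) · #Ш(C^{(p⁻¹)})` is as predicted by the Birch and Swinnerton-Dyer
[formula] for `C^{(p)}` and `C^{(p⁻¹)}`" (`C^{(n)} : x³ + y³ = 2n`; `p* = p^{±1} ≡ 2 mod 9`).
Transcription (module docstring): `W₁`, `W₂` any globally minimal models `ℚ`-isomorphic to
`cubeSumTwoModel p 1` (`x³ + y³ = 2p`) and `cubeSumTwoModel p 2` (`x³ + y³ = 2p² ≅ 2p⁻¹`);
"`2p*` a cube sum" = `IsCubeSum (2p)` (`p ≡ 2`) / `IsCubeSum (2/p)` (`p ≡ 5`); the rank-one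
curve is `W₁` resp. `W₂`; the `ℓ`-part clause as Miller's shape for the PRODUCT:
`shaAn W₁ · shaAn W₂ = q ∈ ℚ` with `ord_ℓ q = ord_ℓ (#Ш(W₁)[ℓ^∞] · #Ш(W₂)[ℓ^∞])`. The primes
`ℓ = 2` and `ℓ = p` are EXCLUDED, as printed. PUBLISHED (refereed).
[cite: CaiShuTian2017, Thm. 1.2 (arXiv:1412.1950 chunk p0002 L16–L23), proof (chunk p0017 L51–L69)] [cite: KezukaLi2020, (4.1) (p. 2139)] [cite: Miller2011LMS, Def. 1.1] -/
def thm12_bsd_cubeSum_twicePrime : Prop :=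
  ∀ (p : ℕ), p.Prime → p ≠ 2 → (p % 9 = 2 ∨ p % 9 = 5) →
    ∀ (W₁ W₂ : WeierstrassCurve ℚ) [W₁.IsElliptic] [W₁.IsGloballyMinimal] [W₂.IsElliptic]
      [W₂.IsGloballyMinimal],
      (∃ C : VariableChange ℚ, C • W₁ = cubeSumTwoModel p 1) →
      (∃ C : VariableChange ℚ, C • W₂ = cubeSumTwoModel p 2) →
      (p % 9 = 2 → IsCubeSum (2 * (p : ℚ))) ∧ (p % 9 = 5 → IsCubeSum (2 / (p : ℚ))) ∧
      (p % 9 = 2 → W₁.analyticRank = 1 ∧ W₁.mordellWeilRank = 1 ∧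
        W₂.analyticRank = 0 ∧ W₂.mordellWeilRank = 0) ∧
      (p % 9 = 5 → W₂.analyticRank = 1 ∧ W₂.mordellWeilRank = 1 ∧
        W₁.analyticRank = 0 ∧ W₁.mordellWeilRank = 0) ∧
      Finite W₁.sha ∧ Finite W₂.sha ∧
      ∀ ℓ : ℕ, ℓ.Prime → ¬ ℓ ∣ 2 * p →
        ∃ q : ℚ, shaAn W₁ * shaAn W₂ = (q : ℂ) ∧
          padicValRat ℓ q =
            padicValNat ℓ (Nat.card (AddCommGroup.primaryComponent W₁.sha ℓ) *
              Nat.card (AddCommGroup.primaryComponent W₂.sha ℓ))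

end Literature.NumberTheory.EllipticCurves.CaiShuTian2017
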